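import Summits.QuantumFields.YangMills.Theorems.UnitScaleTiltProp8ChartHInvLetter
import Summits.QuantumFields.YangMills.Theorems.UnitScaleTiltProp8ChartRemainderOfH
import Summits.QuantumFields.YangMills.Theorems.UnitScaleTiltProp8FlatCubeOperators
import HarnessLib

/-!
# Route `UnitScaleTilt`, crux K1 «MinimiserStabilityRegPr» (stmt-QuantumFields-19200), leaf V2′ — the P2→P3 BRIDGE (hH of `ChartRemainderAt`),
# part D: **PILLAR P3a FROM PILLAR P2 — `ChartRemainderAt` FROM `FlatOpsAdmAtMS`** (the hH conjunct at the carrier, from P2's flat `H` and its (46) letter)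

Cell `ym3-torus`, seat `ym3-torus-p1` g18.  At the d = 3 carrier (`T3Family`, `η = L^{−(K−n)}`, weights `IsLevWeight`): P2's canonical flat operator `H`
(`IsFlatH`: `H = GQ*(QGQ*)⁻¹` of the family, (157)) is a right inverse of the multi-level straight average on the index bonds (`FlatCubeOperators.QE_hOp`), and the
first conjunct of its guarded (46) letter `HSupLetterG` is exactly the weighted letter the bridge of part C consumes; so (`hH_of_flatH`) every admissible family
(`Adm22 D R M`, `2L ≤ R·M + 1`) carries a ℂ-linear right inverse of the TRUE linearisation `fderiv ℂ (chartLog η D) 0` (p544829: `= η·Q^{(j)}`) with the letter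
`w₁(b)‖HX(b)‖ ≤ B₀(1+10L)(1+10L+10L²)·‖X‖_∞` — the third conjunct (hH) of the P3 text `Prop8Chart.ChartRemainderAt` (p539223).  Consequently
(`chartRemainderAt_of_flatOpsAdmAtMS`, with ★ym-ust-19200-p2 g6's `chartRemainder_hCd_hCq`): **the P2 text of record `FlatCubeOpsText.FlatOpsAdmAtMS L R₀ M₀ B₀ δ₀ B₃`
implies `ChartRemainderAt L (max (2L) R₀) (max 1 M₀) C₂ R (B₀(1+10L)(1+10L+10L²))`**, and the v8 stub shape of P3a follows from the v8 stub shape of P2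
(`exists_chartRemainderAt_of_flatOpsAdmAtMS`): pillar P3a `stub_chartRemainder` is CLOSED MODULO pillar P2 `stub_flatOpsCubeSeq` — no separate hH row is needed.
Theorems only; nothing of Bałaban's asserted (P2 itself is gap G-F3′-L0).  NOT a claim about the mass gap.

References: T. Bałaban, CMP **102** (1985) 277–309 [Balaban1985Variational] ((44)–(48) p.285, (156)–(157) p.302); CMP **98** (1985) 17–51 [Balaban1985Averaging]
(Prop. 3 p.36); CMP **96** (1984) 223–250 [Balaban1984PropagatorsII] ((2.1)–(2.2) p.224, (2.35) p.228).
-/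

noncomputable section

open scoped BigOperators Matrix.Norms.L2Operator

namespace Summit.QuantumFields.YangMills.Theorems.ChartHInv

open Literature.MathematicalPhysics.QuantumFieldTheory.Balaban1983to89
open T4Continuum BlockAveraging BlockAveragingEMLLinearised LatticeFieldCalculus
open B6SectADomainsV1 (Domains)
open B6SectAOperatorsV1 (BondIdx QE QsE QE_apply)
open B6SectAVectorModelV1 (GE EE)
open B6SectA (hOp)
open B11Eq115Space (levOf)
open T3ContinuumYM3Torus (T3Family)
open Summit.QuantumFields.YangMills.Theorems.FlatCubeOpsText (Adm22 IsLevWeight IsFlatH HSupLetterG FlatOpsAdmAtMS FlatOpsAdmPowAt)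
open Summit.QuantumFields.YangMills.Theorems.Prop8Chart (chartLog ChartRemainderAt fderiv_chartLog_zero_apply chartRemainder_hCd_hCq
  chartRemainder_constants_pos)

/-! ## §1 P2's flat `H` inverts the straight averages -/

/-- **`IsFlatH` ⇒ `Q_j(HX)(c) = X(j, c)` ON THE INDEX BONDS** ((45): `QH = I`, `FlatCubeOperators.QE_hOp` read on plain functions).
[cite: Balaban1985Variational, (45) p.285; Balaban1984PropagatorsII, (2.35) p.228] -/
theorem bondAvgIter_of_isFlatH (F : T3Family) (n K : ℕ) (D : Domains (F.P K)) (H : (BondIdx D → ℝ) →ₗ[ℝ] (PBond (F.P K) 0 → ℝ))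
    (hH : IsFlatH F n K D H) (X : BondIdx D → ℝ) (i : BondIdx D) : bondAvgIter (i.1.1 : ℕ) (H X) i.1.2 = X i := by
  have hfun : H X = WithLp.ofLp (hOp (GE D (c := (F.L : ℝ) ^ (K - n)) (pow_ne_zero _ (Nat.cast_ne_zero.2 (F.P K).L_pos.ne'))
      (w := fun _ => (1 : ℝ)) (fun _ => one_pos)) (QsE D) (EE D (c := (F.L : ℝ) ^ (K - n)) (pow_ne_zero _ (Nat.cast_ne_zero.2 (F.P K).L_pos.ne'))
      (w := fun _ => (1 : ℝ)) (fun _ => one_pos)) (WithLp.toLp 2 X)) := funext fun b => hH X b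
  rw [hfun, ← QE_apply, FlatCubeOperators.QE_hOp]

/-! ## §2 The hH conjunct of `ChartRemainderAt` at an admissible family, from P2's `H` -/

/-- **hH FROM P2's FLAT `H`**: at the carrier, for a nested family `D` with `D.k = K − n`, (2.2)-admissible with `2L ≤ R·M + 1`, the level weights `w`, and a real
operator `H₀` with `IsFlatH` and the guarded (46) letter `HSupLetterG … B₀` (`B₀ ≥ 0`): a ℂ-linear right inverse of `fderiv ℂ (chartLog η D) 0` with
`w 1 b·‖HX(b)‖ ≤ B₀(1+10L)(1+10L+10L²)·t` for `‖X‖_∞ ≤ t`. [cite: Balaban1985Variational, (45)-(46) p.285, (156)-(157) p.302] -/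
theorem hH_of_flatH (F : T3Family) (n K : ℕ) (D : Domains (F.P K)) (hDk : D.k = K - n) {R M : ℕ} (hAdm : Adm22 D R M) (hRM : 2 * F.L ≤ R * M + 1)
    (w : ℕ → PBond (F.P K) 0 → ℝ) (hw : IsLevWeight F n K D w) (H₀ : (BondIdx D → ℝ) →ₗ[ℝ] (PBond (F.P K) 0 → ℝ)) (hH₀ : IsFlatH F n K D H₀)
    {B₀ : ℝ} (hB₀ : 0 ≤ B₀) (hsup : HSupLetterG F n K D w H₀ B₀) :
    ∃ H : (BondIdx D → Matrix (Fin 2) (Fin 2) ℂ) →ₗ[ℂ] (PBond (F.P K) 0 → Matrix (Fin 2) (Fin 2) ℂ),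
      (∀ X : BondIdx D → Matrix (Fin 2) (Fin 2) ℂ,
          (fderiv ℂ (chartLog (((F.L : ℝ)⁻¹) ^ (K - n)) D :
            (PBond (F.P K) 0 → Matrix (Fin 2) (Fin 2) ℂ) → BondIdx D → Matrix (Fin 2) (Fin 2) ℂ) 0) (H X) = X) ∧
      ∀ (X : BondIdx D → Matrix (Fin 2) (Fin 2) ℂ) (t : ℝ), 0 ≤ t → (∀ i, ‖X i‖ ≤ t) → ∀ b,
        w 1 b * ‖H X b‖ ≤ B₀ * ((1 + 2 * ((3 + 2) * F.L : ℕ)) * (1 + 2 * ((3 + 2) * F.L : ℕ) + 2 * ((3 + 2) * F.L : ℕ) * F.L)) * t := by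
  obtain ⟨Q, hQ0, hQs⟩ := exists_linFamily (P := F.P K) (n := Fin 2)
  have hη : 0 < ((F.L : ℝ)⁻¹) ^ (K - n) := by have := (F.P K).L_pos; positivity
  have hw₁ : ∀ b : PBond (F.P K) 0, w 1 b = ((F.P K).L : ℝ) ^ levOf (fun i => {z : Site (F.P K) 0 | D.InOm i z}) D.k b.src * ((F.L : ℝ)⁻¹) ^ (K - n) := by
    intro b; rw [hw 1 b, pow_one, hDk]; rfl
  obtain ⟨H, hinvC, hlet⟩ := exists_rightInverse (n := Fin 2) D hAdm hRM hη (w 1) hw₁ H₀ (bondAvgIter_of_isFlatH F n K D H₀ hH₀) hB₀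
    (fun Xr t ht hXr => (hsup Xr t ht hXr).1) Q hQ0 hQs
  refine ⟨H, fun X => funext fun idx => ?_, fun X t ht hX b => hlet X t ht hX b⟩
  rw [fderiv_chartLog_zero_apply _ D Q hQ0 hQs]
  exact hinvC X idx

/-- **THE hH CLAUSE OF `ChartRemainderAt` FROM THE P2 TEXT OF RECORD `FlatOpsAdmAtMS`**, at the thresholds `R′ ≥ max (2L) R₀`, `M ≥ max 1 M₀`.
[cite: Balaban1985Variational, (45)-(46) p.285, (156)-(157) p.302, (161) p.303] -/
theorem hH_of_flatOpsAdmAtMS {L R₀ M₀ : ℕ} {B₀ δ₀ B₃ : ℝ} (hB₀ : 0 ≤ B₀) (hP2 : FlatOpsAdmAtMS L R₀ M₀ B₀ δ₀ B₃) :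
    ∀ (F : T3Family), F.L = L → ∀ (n K : ℕ), n < K → ∀ (R' M : ℕ), max (2 * L) R₀ ≤ R' → max 1 M₀ ≤ M → (∃ a : ℕ, M = L ^ a) →
      ∀ (D : Domains (F.P K)), D.k = K - n → Adm22 D R' M →
      ∀ (w : ℕ → PBond (F.P K) 0 → ℝ), IsLevWeight F n K D w →
        ∃ H : (BondIdx D → Matrix (Fin 2) (Fin 2) ℂ) →ₗ[ℂ] (PBond (F.P K) 0 → Matrix (Fin 2) (Fin 2) ℂ),
          (∀ X : BondIdx D → Matrix (Fin 2) (Fin 2) ℂ,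
              (fderiv ℂ (chartLog (((F.L : ℝ)⁻¹) ^ (K - n)) D :
                (PBond (F.P K) 0 → Matrix (Fin 2) (Fin 2) ℂ) → BondIdx D → Matrix (Fin 2) (Fin 2) ℂ) 0) (H X) = X) ∧
          ∀ (X : BondIdx D → Matrix (Fin 2) (Fin 2) ℂ) (t : ℝ), 0 ≤ t → (∀ i, ‖X i‖ ≤ t) → ∀ b,
            w 1 b * ‖H X b‖ ≤ B₀ * ((1 + 2 * ((3 + 2) * L : ℕ)) * (1 + 2 * ((3 + 2) * L : ℕ) + 2 * ((3 + 2) * L : ℕ) * L)) * t := by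
  intro F hF n K hnK R' M hR' hM hpow D hDk hAdm w hw
  obtain ⟨H₀, Gt, hH₀, -, hsup, -⟩ := hP2 F hF n K hnK R' M ((le_max_right _ _).trans hR') ((le_max_right _ _).trans hM) hpow D hDk hAdm w hw
  have hRM : 2 * F.L ≤ R' * M := by
    have h1 : 2 * L ≤ R' := (le_max_left _ _).trans hR'
    have h2 : 1 ≤ M := (le_max_left _ _).trans hM
    rw [hF]; nlinarith
  subst hF
  exact hH_of_flatH F n K D hDk hAdm (by omega) w hw H₀ hH₀ hB₀ hsup

/-! ## §3 `ChartRemainderAt` from `FlatOpsAdmAtMS`; the v8 stub shape of P3a from that of P2 -/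

/-- **PILLAR P3a FROM PILLAR P2**: `FlatOpsAdmAtMS L R₀ M₀ B₀ δ₀ B₃` (`B₀ ≥ 0`) implies
`ChartRemainderAt L (max (2L) R₀) (max 1 M₀) C₂ R (B₀(1+10L)(1+10L+10L²))` with ★ym-ust-19200-p2 g6's k-uniform `C₂ = 960·5L·L/R⋆`, `R = R⋆/4`, `R⋆ = (12800·(5L)²·L)⁻¹`
(hCd, hCq theorems; hH from §2). [cite: Balaban1985Variational, (44)-(48) p.285, (156)-(157) p.302] -/
theorem chartRemainderAt_of_flatOpsAdmAtMS {L R₀ M₀ : ℕ} {B₀ δ₀ B₃ : ℝ} (hB₀ : 0 ≤ B₀) (hP2 : FlatOpsAdmAtMS L R₀ M₀ B₀ δ₀ B₃) :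
    ChartRemainderAt L (max (2 * L) R₀) (max 1 M₀)
      (960 * (((3 + 2) * L : ℕ) : ℝ) * (L : ℝ) / (12800 * (((3 + 2) * L : ℕ) : ℝ) ^ 2 * (L : ℝ))⁻¹)
      ((12800 * (((3 + 2) * L : ℕ) : ℝ) ^ 2 * (L : ℝ))⁻¹ / 4)
      (B₀ * ((1 + 2 * ((3 + 2) * L : ℕ)) * (1 + 2 * ((3 + 2) * L : ℕ) + 2 * ((3 + 2) * L : ℕ) * L))) := by
  intro F hF n K hnK R' M hR' hM hpow D hDk hAdm w hw
  have hH := hH_of_flatOpsAdmAtMS hB₀ hP2 F hF n K hnK R' M hR' hM hpow D hDk hAdm w hw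
  subst hF
  obtain ⟨hd, hq⟩ := chartRemainder_hCd_hCq F n K (R' := R') (M := M) ((le_max_left _ _).trans hR') ((le_max_left _ _).trans hM) D hDk hAdm hw
  exact ⟨hd, hq, hH⟩

/-- **THE v8 STUB SHAPE OF P3a FROM THE v8 STUB SHAPE OF P2**: for `L ≥ 1`,
`(∃ R₀ M₀ B₀ δ₀ B₃, 0 < B₀ ∧ 0 < δ₀ ∧ 0 < B₃ ∧ FlatOpsAdmAtMS L R₀ M₀ B₀ δ₀ B₃) → ∃ R₀ M₀ C₂ R B₀′, 0 ≤ C₂ ∧ 0 < R ∧ 0 ≤ B₀′ ∧ ChartRemainderAt L R₀ M₀ C₂ R B₀′` —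
pillar P3a `stub_chartRemainder` is closed modulo pillar P2 `stub_flatOpsCubeSeq`. [cite: Balaban1985Variational, (44)-(48) p.285, (156)-(157) p.302] -/
theorem exists_chartRemainderAt_of_flatOpsAdmAtMS {L : ℕ} (hL : 1 ≤ L)
    (hP2 : ∃ (R₀ M₀ : ℕ) (B₀ δ₀ B₃ : ℝ), 0 < B₀ ∧ 0 < δ₀ ∧ 0 < B₃ ∧ FlatOpsAdmAtMS L R₀ M₀ B₀ δ₀ B₃) :
    ∃ (R₀ M₀ : ℕ) (C₂ R B₀' : ℝ), 0 ≤ C₂ ∧ 0 < R ∧ 0 ≤ B₀' ∧ ChartRemainderAt L R₀ M₀ C₂ R B₀' := by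
  obtain ⟨R₀, M₀, B₀, δ₀, B₃, hB₀, -, -, h⟩ := hP2
  obtain ⟨hC, hR⟩ := chartRemainder_constants_pos (L := L) hL
  exact ⟨_, _, _, _, _, hC, hR, by positivity, chartRemainderAt_of_flatOpsAdmAtMS hB₀.le h⟩

end Summit.QuantumFields.YangMills.Theorems.ChartHInv

end
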